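import Literature.Probability.RandomPlanarGeometry.LoewnerDescriptionProofs
import Literature.Probability.RandomPlanarGeometry.SLETraceApproximation
import Literature.Probability.RandomPlanarGeometry.SLELawOfDrivingProcess
import HarnessLib

/-!
# The driving function of a curve class is a Borel function of the curve

Topic `Literature/Probability/RandomPlanarGeometry` (family `crit-ising`); theorems only. The
scaling-limit theorems of Kemppainen–Smirnov (Ann. Probab. 45 (2017), Thm. 1.5 and Cor. 1.7) and
of Chelkak–Duminil-Copin–Hongler–Kemppainen–Smirnov (C. R. Math. 352 (2014), Thm. 3 and §3) speak
of *the driving process* `W(·, Φγ)` of a random curve `γ` in `(D; a, b)` (Kemppainen–Smirnov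
2017, §1.2: "the driving term or process of a curve or a random curve in `𝔻` means the driving
term or process in `ℍ` after the transformation `Φ` and using the half-plane capacity
parametrization"; §3.3: "Denote by `W(·, Φγ)` the driving process of `Φγ`") and of its law,
which presupposes that the Loewner transform `c ↦ W(c)` is a measurable function of the curve. In
the tree the transform is `drivingFunction φ c` (`LoewnerDescription.lean`: the driving function
describing the curve class `c` through the chordal uniformizing map `φ : ℍ → D`, unique by
`IsLoewnerDescribed.driving_unique_holds`, junk `0` on non-describable classes), and the layer-5
fact (M5′) `LatticeModels.exists_cylinderObservableIdentity_fkInterface` of the decomposition of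
CDHKS Thm. 2 asks for a driving process on `(CurveClass ℂ, μ)` with (strongly) measurable
marginals. This file PROVES that measurability, with no hypothesis beyond `φ` being a chordal
uniformizing map of the Dobrushin domain:

* `measurableSet_setOf_isLoewnerDescribable` — the set of curve classes describable by the
  Loewner evolution through `φ` is Borel;
* `measurable_drivingFunction` — `c ↦ drivingFunction φ c` is Borel measurable into the path
  space `[0, ∞) → ℝ` (product σ-algebra), i.e. every marginal `c ↦ W_t(c)` is measurable
  (`measurable_drivingFunction_apply`, `stronglyMeasurable_drivingFunction_apply`), and into
  `C([0, ∞), ℝ)` with its Borel σ-algebra (`measurable_drivingPathOf`, scoped instances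
  `PathBorel` of `SLETraceApproximation.lean`);
* `measurable_trace_drivingFunction` — the capacity-parametrised pull-back `Loewner.trace (W(c))`
  of the curve to `ℍ` is a measurable function of `c` as well;
* `measurableSet_setOf_isLoewnerDescribed` — the set of pairs `(c, W)` with `c` described by `W`
  (the set carrying the joint subsequential limits of Kemppainen–Smirnov's Cor. 1.7: "the limits
  agree in the sense that `γ = lim γₙ` is driven by `W = lim Wₙ`") is Borel in
  `CurveClass ℂ × C([0, ∞), ℝ)`;
* consequences: the hypothesis "the driving function is a.e.-measurable" of
  `exists_isSLEDrivingCoupling_of_drivingFunction` / `isSLELaw_of_drivingFunction`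
  (`LoewnerDescription.lean`) is discharged (`exists_isSLEDrivingCoupling_of_drivingFunction'`,
  `isSLELaw_of_drivingFunction'`), and a coupling `ν` of a curve law with continuous paths under
  which a.e. the path drives the curve is the graph coupling of the driving function
  (`ae_eq_drivingFunction_of_ae_isDrivenBy`, `eq_map_prod_drivingFunction_of_ae_isDrivenBy`,
  `snd_eq_map_drivingFunction_of_ae_isDrivenBy`: "if either `(γₙ)` or `(Wₙ)` converges, also
  the other one converges and the limits agree", Kemppainen–Smirnov 2017, Cor. 1.7, in the form:
  the law of the limit pair is determined by the law of the limit curve).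

Proof (Lusin–Souslin, as in `SLETraceApproximation.lean` and `SLEExistence.lean`; Kechris,
*Classical Descriptive Set Theory* (1995), Thm. 15.1): in the Polish space
`CurveClass ℂ × ((C([0,∞), ℂ) × C([0,∞), ℝ)) × C([0,1], ℂ))` the set `G` of quadruples
`(c, γ, W, f)` with the chain of `W` generated by `γ` (the CLOSED set `generatedPairs`,
Lawler–Schramm–Werner's Lemma 3.14), `f(s) = Φ(γ(s/(1-s)))` for `s < 1` (with `Φ` the boundary
extension of `φ`, continuous on the closed half-plane by Carathéodory's theorem, precomposed with
the retraction `liftIm 0` onto it), `f(1) = b` and `c = [f]` is closed; the first projection is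
injective on `G` (the driving function of a class is unique, `driving_unique_holds`; the
generating curve of a chain is unique, `IsGeneratedByCurve.unique_holds`; the compactified image
is unique), so its image — the set of describable classes — is Borel and the inverse is a
measurable embedding (Mathlib `Measurable.measurableEmbedding`,
`MeasurableEmbedding.measurable_extend`), of which `drivingFunction φ` and
`trace ∘ drivingFunction φ` are coordinates extended by their junk values.

No definition and no named fact is introduced.

## References

* A. Kemppainen, S. Smirnov, *Random curves, scaling limits and Loewner evolutions*, Ann.
  Probab. 45 (2017) 698–779 (arXiv:1212.6215), §1.2 (driving process of a random curve),
  Thm. 1.5, Cor. 1.7, §3.3.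
* D. Chelkak, H. Duminil-Copin, C. Hongler, A. Kemppainen, S. Smirnov, C. R. Math. Acad. Sci.
  Paris 352 (2014) 157–161, Thm. 3 and §3.
* G. F. Lawler, *Conformally Invariant Processes in the Plane*, AMS (2005), §4.1 (Loewner
  transform).
* A. S. Kechris, *Classical Descriptive Set Theory*, Springer (1995), Thm. 15.1 (Lusin–Souslin).
-/

noncomputable section

open Set Filter Topology MeasureTheory
open UpperHalfPlane (upperHalfPlaneSet)
open scoped NNReal unitInterval

namespace Literature.Probability.RandomPlanarGeometry

open scoped PathBorel

variable {D : DobrushinDomain} {φ : ConformalEquiv upperHalfPlaneSet D.carrier}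

/-! ### `IsLoewnerDescribed` and `Loewner.IsDrivenBy` -/

/-- `IsLoewnerDescribed φ c W` is `Loewner.IsDrivenBy` through the boundary extension of `φ` with
end point `b = D.pt 1`, plus continuity of `W` (unfolding). [folklore] -/
theorem isLoewnerDescribed_iff_isDrivenBy {c : CurveClass ℂ} {W : ℝ≥0 → ℝ} :
    IsLoewnerDescribed φ c W ↔
      Continuous W ∧ Loewner.IsDrivenBy φ.boundaryExtension (D.pt 1) W c :=
  Iff.rfl

/-- A continuous function driving the curve class `c` through `φ` describes it. [folklore] -/
theorem Loewner.IsDrivenBy.isLoewnerDescribed {c : CurveClass ℂ} {W : ℝ≥0 → ℝ}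
    (h : Loewner.IsDrivenBy φ.boundaryExtension (D.pt 1) W c) (hW : Continuous W) :
    IsLoewnerDescribed φ c W :=
  ⟨hW, h⟩

/-- A continuous function driving the curve class `c` through a chordal uniformizing map `φ` IS
the driving function of `c` (uniqueness, `IsLoewnerDescribed.driving_unique_holds`).
[cite: Lawler2005, §4.1 p. 99] -/
theorem Loewner.IsDrivenBy.drivingFunction_eq (hφ : D.IsChordalUniformizing φ) {c : CurveClass ℂ}
    {W : ℝ≥0 → ℝ} (h : Loewner.IsDrivenBy φ.boundaryExtension (D.pt 1) W c) (hW : Continuous W) :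
    drivingFunction φ c = W :=
  IsLoewnerDescribed.drivingFunction_eq IsLoewnerDescribed.driving_unique_holds hφ
    (h.isLoewnerDescribed hW)

/-! ### The Lusin–Souslin argument -/

/-- The boundary extension of `φ` precomposed with the retraction `liftIm 0` of `ℂ` onto the
closed upper half-plane is continuous on `ℂ` (Carathéodory: the boundary extension is continuous
on the closed half-plane, `JordanDomain.continuousOn_boundaryExtension_holds`). [folklore] -/
theorem continuous_boundaryExtension_liftIm (φ : ConformalEquiv upperHalfPlaneSet D.carrier) :
    Continuous fun z ↦ φ.boundaryExtension (Loewner.liftIm 0 z) := by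
  have hc : ContinuousOn φ.boundaryExtension (closure upperHalfPlaneSet) :=
    JordanDomain.continuousOn_boundaryExtension_holds D.toJordanDomain φ
  refine hc.comp_continuous (Loewner.lipschitzWith_liftIm 0).continuous fun z ↦ ?_
  rw [ConformalEquiv.closure_upperHalfPlaneSet_eq]
  exact Loewner.le_im_liftIm 0 z

/-- **The measurability package** (one Lusin–Souslin argument, four conclusions): for a chordal
uniformizing map `φ` of `(D; a, b)`, the set of describable curve classes is Borel, the driving
function and the capacity-parametrised pull-back `trace ∘ drivingFunction` are Borel functions of
the curve class (product σ-algebras on the path spaces), and the set of described pairs `(c, W)`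
is Borel in `CurveClass ℂ × C([0, ∞), ℝ)`. See the module docstring for the proof.
(Kechris 1995, Thm. 15.1; Kemppainen–Smirnov 2017, §1.2.) [folklore] -/
theorem measurable_drivingFunction_package (hφ : D.IsChordalUniformizing φ) :
    MeasurableSet {c : CurveClass ℂ | IsLoewnerDescribable φ c} ∧
      Measurable (drivingFunction φ) ∧
      (Measurable fun c ↦ Loewner.trace (drivingFunction φ c)) ∧
      MeasurableSet {p : CurveClass ℂ × C(ℝ≥0, ℝ) | IsLoewnerDescribed φ p.1 p.2} := by
  -- Borel structure on `C([0, 1], ℂ)` (local; Mathlib registers none)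
  letI : MeasurableSpace C(I, ℂ) := borel _
  haveI : BorelSpace C(I, ℂ) := ⟨rfl⟩
  set Φ : ℂ → ℂ := φ.boundaryExtension with hΦdef
  set b : ℂ := D.pt 1 with hbdef
  have hΦc : Continuous fun z ↦ Φ (Loewner.liftIm 0 z) := continuous_boundaryExtension_liftIm φ
  -- the closed set `G`
  set G₁ : Set (CurveClass ℂ × ((C(ℝ≥0, ℂ) × C(ℝ≥0, ℝ)) × C(I, ℂ))) :=
    {q | q.2.1 ∈ generatedPairs} with hG₁
  set G₂ : Set (CurveClass ℂ × ((C(ℝ≥0, ℂ) × C(ℝ≥0, ℝ)) × C(I, ℂ))) :=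
    {q | ∀ s : I, (s : ℝ) < 1 → q.2.2 s = Φ (Loewner.liftIm 0 (q.2.1.1 (rayParam s)))} with hG₂
  set G₃ : Set (CurveClass ℂ × ((C(ℝ≥0, ℂ) × C(ℝ≥0, ℝ)) × C(I, ℂ))) :=
    {q | q.2.2 1 = b} with hG₃
  set G₄ : Set (CurveClass ℂ × ((C(ℝ≥0, ℂ) × C(ℝ≥0, ℝ)) × C(I, ℂ))) :=
    {q | q.1 = CurveClass.mk ⟨q.2.2⟩} with hG₄
  set G : Set (CurveClass ℂ × ((C(ℝ≥0, ℂ) × C(ℝ≥0, ℝ)) × C(I, ℂ))) := (G₁ ∩ G₂) ∩ (G₃ ∩ G₄)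
    with hGdef
  have hGc : IsClosed G := by
    refine (IsClosed.inter ?_ ?_).inter (IsClosed.inter ?_ ?_)
    · exact isClosed_generatedPairs.preimage (by fun_prop)
    · rw [hG₂, setOf_forall]
      refine isClosed_iInter fun s ↦ ?_
      by_cases hs : (s : ℝ) < 1
      · simp only [hs, forall_true_left]
        exact isClosed_eq ((continuous_eval_const s).comp (by fun_prop))
          (hΦc.comp ((continuous_eval_const (rayParam s)).comp (by fun_prop)))
      · simp only [hs, IsEmpty.forall_iff, setOf_true]
        exact isClosed_univ
    · exact isClosed_eq ((continuous_eval_const (1 : I)).comp (by fun_prop))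
        continuous_const
    · exact isClosed_eq continuous_fst
        (CurveClass.continuous_mk.comp (continuous_curveMk.comp (by fun_prop)))
  have hG : MeasurableSet G := hGc.measurableSet
  -- membership in `G` gives a description of the class by the `W`-coordinate
  have key : ∀ q ∈ G, IsLoewnerDescribed φ q.1 q.2.1.2 ∧
      IsCompactifiedImage Φ q.2.1.1 b ⟨q.2.2⟩ := by
    rintro ⟨c, ⟨γ, W⟩, f⟩ ⟨⟨h₁, h₂⟩, h₃, h₄⟩
    have hgen : Loewner.IsGeneratedByCurve W γ := h₁
    have hI : IsCompactifiedImage Φ γ b ⟨f⟩ := by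
      refine ⟨fun s hs ↦ ?_, h₃⟩
      have := h₂ s hs
      rw [Loewner.liftIm_of_le (hgen.im_nonneg _)] at this
      exact this
    exact ⟨⟨W.continuous, γ, hgen, ⟨f⟩, h₄, hI⟩, hI⟩
  -- conversely, a description gives a point of `G`
  have mem_of : ∀ {c : CurveClass ℂ} {W : ℝ≥0 → ℝ} (hW : Continuous W) {γ : ℝ≥0 → ℂ}
      (hγ : Loewner.IsGeneratedByCurve W γ) {c' : Curve ℂ}, c = CurveClass.mk c' →
      IsCompactifiedImage Φ γ b c' →
      ((c, ((⟨γ, hγ.continuous⟩, ⟨W, hW⟩), c'.toContinuousMap)) :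
        CurveClass ℂ × ((C(ℝ≥0, ℂ) × C(ℝ≥0, ℝ)) × C(I, ℂ))) ∈ G := by
    intro c W hW γ hγ c' hc hI
    refine ⟨⟨?_, fun s hs ↦ ?_⟩, hI.2, ?_⟩
    · simpa [hG₁] using hγ
    · show c' s = Φ (Loewner.liftIm 0 (γ (rayParam s)))
      rw [Loewner.liftIm_of_le (hγ.im_nonneg _)]
      exact hI.1 s hs
    · simpa [hG₄] using hc
  -- the first projection is injective on `G`
  have hinj : InjOn Prod.fst G := by
    rintro ⟨c, ⟨γ, W⟩, f⟩ hq ⟨c', ⟨γ', W'⟩, f'⟩ hq' (hcc : c = c')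
    subst hcc
    obtain ⟨hd, hI⟩ := key _ hq
    obtain ⟨hd', hI'⟩ := key _ hq'
    have hWW : (W : ℝ≥0 → ℝ) = W' := IsLoewnerDescribed.driving_unique_holds hφ hd hd'
    obtain rfl : W = W' := DFunLike.coe_injective hWW
    have hgen : Loewner.IsGeneratedByCurve W γ := hq.1.1
    have hgen' : Loewner.IsGeneratedByCurve W γ' := hq'.1.1
    have hγγ : (γ : ℝ≥0 → ℂ) = γ' :=
      Loewner.IsGeneratedByCurve.unique_holds W.continuous hgen hgen'
    obtain rfl : γ = γ' := DFunLike.coe_injective hγγ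
    have hff : (⟨f⟩ : Curve ℂ) = ⟨f'⟩ := hI.unique hI'
    obtain rfl : f = f' := by
      simpa using hff
    rfl
  -- the image of `G` is the set of describable classes
  have himage : Prod.fst '' G = {c | IsLoewnerDescribable φ c} := by
    ext c
    constructor
    · rintro ⟨q, hq, rfl⟩
      exact ⟨_, (key q hq).1⟩
    · rintro ⟨W, hW, γ, hγ, c', hc, hI⟩
      exact ⟨_, mem_of hW hγ hc hI, rfl⟩
  -- Lusin–Souslin
  haveI : StandardBorelSpace G := hG.standardBorel
  set F : G → CurveClass ℂ := fun q ↦ (q : CurveClass ℂ × ((C(ℝ≥0, ℂ) × C(ℝ≥0, ℝ)) × C(I, ℂ))).1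
    with hFdef
  have hFm : Measurable F := measurable_fst.comp measurable_subtype_coe
  have hFi : Function.Injective F := fun q q' h ↦ Subtype.ext (hinj q.2 q'.2 h)
  have hFe : MeasurableEmbedding F := hFm.measurableEmbedding hFi
  have hrange : range F = {c | IsLoewnerDescribable φ c} := by
    rw [← himage]
    ext c
    simp only [mem_range, mem_image, Subtype.exists, hFdef]
    constructor
    · rintro ⟨q, hq, rfl⟩
      exact ⟨q, hq, rfl⟩
    · rintro ⟨q, hq, rfl⟩
      exact ⟨q, hq, rfl⟩
  have hdesc_of_not : ∀ c, c ∉ range F → ¬ IsLoewnerDescribable φ c := fun c hc h ↦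
    hc (by rw [hrange]; exact h)
  -- (1) describable classes
  have h1 : MeasurableSet {c : CurveClass ℂ | IsLoewnerDescribable φ c} := by
    rw [← hrange]
    exact hFe.measurableSet_range
  -- (2) the driving function as an extension along `F`
  have hWm : Measurable fun q : G ↦
      ((q : CurveClass ℂ × ((C(ℝ≥0, ℂ) × C(ℝ≥0, ℝ)) × C(I, ℂ))).2.1.2 : ℝ≥0 → ℝ) :=
    measurable_pi_lambda _ fun t ↦ (continuous_eval_const t).measurable.comp
      (measurable_snd.comp (measurable_fst.comp (measurable_snd.comp measurable_subtype_coe)))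
  have h2eq : drivingFunction φ = Function.extend F
      (fun q ↦ ((q : CurveClass ℂ × ((C(ℝ≥0, ℂ) × C(ℝ≥0, ℝ)) × C(I, ℂ))).2.1.2 : ℝ≥0 → ℝ))
      (fun _ ↦ 0) := by
    funext c
    by_cases hc : ∃ q, F q = c
    · obtain ⟨q, rfl⟩ := hc
      rw [hFi.extend_apply]
      exact IsLoewnerDescribed.drivingFunction_eq IsLoewnerDescribed.driving_unique_holds hφ
        (key q.1 q.2).1
    · rw [Function.extend_apply' _ _ _ hc]
      exact drivingFunction_of_not (hdesc_of_not c (fun h ↦ hc h))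
  have h2 : Measurable (drivingFunction φ) := by
    rw [h2eq]
    exact hFe.measurable_extend hWm measurable_const
  -- (3) the pulled-back curve
  have hγm : Measurable fun q : G ↦
      ((q : CurveClass ℂ × ((C(ℝ≥0, ℂ) × C(ℝ≥0, ℝ)) × C(I, ℂ))).2.1.1 : ℝ≥0 → ℂ) :=
    measurable_pi_lambda _ fun t ↦ (continuous_eval_const t).measurable.comp
      (measurable_fst.comp (measurable_fst.comp (measurable_snd.comp measurable_subtype_coe)))
  have h3eq : (fun c ↦ Loewner.trace (drivingFunction φ c)) = Function.extend F
      (fun q ↦ ((q : CurveClass ℂ × ((C(ℝ≥0, ℂ) × C(ℝ≥0, ℝ)) × C(I, ℂ))).2.1.1 : ℝ≥0 → ℂ))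
      (fun _ ↦ Loewner.trace (0 : ℝ≥0 → ℝ)) := by
    funext c
    by_cases hc : ∃ q, F q = c
    · obtain ⟨q, rfl⟩ := hc
      rw [hFi.extend_apply]
      have hd := (key q.1 q.2).1
      have hgen : Loewner.IsGeneratedByCurve
          ((q : CurveClass ℂ × ((C(ℝ≥0, ℂ) × C(ℝ≥0, ℝ)) × C(I, ℂ))).2.1.2 : ℝ≥0 → ℝ)
          ((q : CurveClass ℂ × ((C(ℝ≥0, ℂ) × C(ℝ≥0, ℝ)) × C(I, ℂ))).2.1.1 : ℝ≥0 → ℂ) :=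
        q.2.1.1
      show Loewner.trace (drivingFunction φ (F q)) = _
      rw [IsLoewnerDescribed.drivingFunction_eq IsLoewnerDescribed.driving_unique_holds hφ hd]
      exact Loewner.IsGeneratedByCurve.trace_eq_holds (ContinuousMap.continuous _) hgen
    · rw [Function.extend_apply' _ _ _ hc]
      show Loewner.trace (drivingFunction φ c) = _
      rw [drivingFunction_of_not (hdesc_of_not c (fun h ↦ hc h))]
  have h3 : Measurable fun c ↦ Loewner.trace (drivingFunction φ c) := by
    rw [h3eq]
    exact hFe.measurable_extend hγm measurable_const
  -- (4) the described pairs: the injective image of `G` under `q ↦ (q.1, q.2.1.2)`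
  have h4 : MeasurableSet {p : CurveClass ℂ × C(ℝ≥0, ℝ) | IsLoewnerDescribed φ p.1 p.2} := by
    have hπm : Measurable fun q : CurveClass ℂ × ((C(ℝ≥0, ℂ) × C(ℝ≥0, ℝ)) × C(I, ℂ)) ↦
        (q.1, q.2.1.2) := measurable_fst.prodMk (measurable_snd.comp (measurable_fst.comp
          measurable_snd))
    have hπi : InjOn (fun q : CurveClass ℂ × ((C(ℝ≥0, ℂ) × C(ℝ≥0, ℝ)) × C(I, ℂ)) ↦
        (q.1, q.2.1.2)) G := fun q hq q' hq' h ↦ hinj hq hq' (Prod.ext_iff.1 h).1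
    have heq : {p : CurveClass ℂ × C(ℝ≥0, ℝ) | IsLoewnerDescribed φ p.1 p.2} =
        (fun q : CurveClass ℂ × ((C(ℝ≥0, ℂ) × C(ℝ≥0, ℝ)) × C(I, ℂ)) ↦ (q.1, q.2.1.2)) '' G := by
      ext p
      constructor
      · rintro ⟨hW, γ, hγ, c', hc, hI⟩
        exact ⟨_, mem_of hW hγ hc hI, Prod.ext rfl (by ext t; rfl)⟩
      · rintro ⟨q, hq, rfl⟩
        exact (key q hq).1
    rw [heq]
    exact hG.image_of_measurable_injOn hπm hπi
  exact ⟨h1, h2, h3, h4⟩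

/-! ### The theorems -/

/-- **The set of curve classes describable by the Loewner evolution through `φ` is Borel.**
(Kemppainen–Smirnov 2017, Thm. 1.5: the event on which a subsequential limit is carried.)
[folklore] -/
theorem measurableSet_setOf_isLoewnerDescribable (hφ : D.IsChordalUniformizing φ) :
    MeasurableSet {c : CurveClass ℂ | IsLoewnerDescribable φ c} :=
  (measurable_drivingFunction_package hφ).1

/-- **The driving function is a Borel function of the curve class**: `c ↦ drivingFunction φ c`
is measurable from the Borel σ-algebra of `CurveClass ℂ` to the product σ-algebra of
`[0, ∞) → ℝ`. Hence "the driving process of a random curve" (Kemppainen–Smirnov 2017, §1.2 and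
§3.3; CDHKS 2014, Thm. 3) is a stochastic process on `(CurveClass ℂ, μ)` for every law `μ`.
[folklore] -/
theorem measurable_drivingFunction (hφ : D.IsChordalUniformizing φ) :
    Measurable (drivingFunction φ) :=
  (measurable_drivingFunction_package hφ).2.1

/-- Every marginal `c ↦ W_t(c)` of the driving process is measurable. [folklore] -/
theorem measurable_drivingFunction_apply (hφ : D.IsChordalUniformizing φ) (t : ℝ≥0) :
    Measurable fun c ↦ drivingFunction φ c t :=
  (measurable_pi_apply t).comp (measurable_drivingFunction hφ)

/-- Every marginal `c ↦ W_t(c)` of the driving process is strongly measurable (the measurability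
clause of (M5′) `LatticeModels.exists_cylinderObservableIdentity_fkInterface` for the choice
`W c = drivingFunction φ c`). [folklore] -/
theorem stronglyMeasurable_drivingFunction_apply (hφ : D.IsChordalUniformizing φ) (t : ℝ≥0) :
    StronglyMeasurable fun c ↦ drivingFunction φ c t :=
  (measurable_drivingFunction_apply hφ t).stronglyMeasurable

/-- The driving function is a.e.-measurable for every measure on curve classes. [folklore] -/
theorem aemeasurable_drivingFunction (hφ : D.IsChordalUniformizing φ)
    (μ : Measure (CurveClass ℂ)) : AEMeasurable (drivingFunction φ) μ :=
  (measurable_drivingFunction hφ).aemeasurable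

/-- **The driving path as a random element of `C([0, ∞), ℝ)`**: `c ↦ drivingFunction φ c`,
bundled as a continuous map (`continuous_drivingFunction`), is Borel measurable for the
compact-open topology (the Borel σ-algebra of path space is generated by the evaluations,
`Process.measurable_continuousMap_of_eval`). This is the form in which laws of driving processes
are compared in Kemppainen–Smirnov's Cor. 1.7 ("the topology of uniform convergence on the
compact intervals of `ℝ₊`"). [folklore] -/
theorem measurable_drivingPathOf (hφ : D.IsChordalUniformizing φ) :
    Measurable fun c ↦ (⟨drivingFunction φ c, continuous_drivingFunction φ c⟩ : C(ℝ≥0, ℝ)) :=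
  Process.measurable_continuousMap_of_eval fun t ↦ measurable_drivingFunction_apply hφ t

/-- **The capacity-parametrised pull-back of the curve is a Borel function of the curve class**:
`c ↦ Loewner.trace (drivingFunction φ c)` (the curve `γ` in `ℍ`, parametrised by half-plane
capacity, with `c = [Φ ∘ γ]` when `c` is describable) is measurable into `[0, ∞) → ℂ`.
(Kemppainen–Smirnov 2017, Cor. 1.7: "`(γ⁽ⁿ⁾)` parametrized by capacity".) [folklore] -/
theorem measurable_trace_drivingFunction (hφ : D.IsChordalUniformizing φ) :
    Measurable fun c ↦ Loewner.trace (drivingFunction φ c) :=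
  (measurable_drivingFunction_package hφ).2.2.1

/-- **The set of described pairs is Borel**: `{(c, W) | IsLoewnerDescribed φ c W}` is a Borel
subset of `CurveClass ℂ × C([0, ∞), ℝ)` — the set carrying the joint subsequential limits
`(γ, W)` of Kemppainen–Smirnov's Cor. 1.7. [folklore] -/
theorem measurableSet_setOf_isLoewnerDescribed (hφ : D.IsChordalUniformizing φ) :
    MeasurableSet {p : CurveClass ℂ × C(ℝ≥0, ℝ) | IsLoewnerDescribed φ p.1 p.2} :=
  (measurable_drivingFunction_package hφ).2.2.2

/-! ### Consequences: couplings under which the path drives the curve -/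

section Coupling

variable {ν : Measure (CurveClass ℂ × (ℝ≥0 → ℝ))}

/-- **Under a coupling in which a.e. the (continuous) path drives the curve, the path IS the
driving function of the curve** (uniqueness of the driving function). This is the sense of
"the limits agree … `γ = lim γₙ` is driven by `W = lim Wₙ`" in Kemppainen–Smirnov (2017),
Cor. 1.7. [cite: Lawler2005, §4.1 p. 99] -/
theorem ae_eq_drivingFunction_of_ae_isDrivenBy (hφ : D.IsChordalUniformizing φ)
    (h : ∀ᵐ p ∂ν, Continuous p.2 ∧ Loewner.IsDrivenBy φ.boundaryExtension (D.pt 1) p.2 p.1) :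
    ∀ᵐ p ∂ν, p.2 = drivingFunction φ p.1 := by
  filter_upwards [h] with p hp
  exact (hp.2.drivingFunction_eq hφ hp.1).symm

/-- Under such a coupling, almost every curve class (for the first marginal `ν.fst`) is
described by its own driving function (the describable classes form a Borel set,
`measurableSet_setOf_isLoewnerDescribable`, so the almost-sure statement passes to the
marginal). [folklore] -/
theorem ae_fst_isLoewnerDescribed_of_ae_isDrivenBy (hφ : D.IsChordalUniformizing φ)
    (h : ∀ᵐ p ∂ν, Continuous p.2 ∧ Loewner.IsDrivenBy φ.boundaryExtension (D.pt 1) p.2 p.1) :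
    ∀ᵐ c ∂ν.fst, IsLoewnerDescribed φ c (drivingFunction φ c) := by
  have hiff : ∀ c, IsLoewnerDescribed φ c (drivingFunction φ c) ↔ IsLoewnerDescribable φ c :=
    fun c ↦ ⟨fun h' ↦ ⟨_, h'⟩, isLoewnerDescribed_drivingFunction⟩
  simp only [hiff]
  rw [Measure.fst, ae_map_iff measurable_fst.aemeasurable
    (measurableSet_setOf_isLoewnerDescribable hφ)]
  filter_upwards [h] with p hp
  exact ⟨p.2, hp.2.isLoewnerDescribed hp.1⟩

/-- **A coupling under which the path drives the curve is the graph coupling of the driving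
function**: `ν = (ν.fst).map (c ↦ (c, drivingFunction φ c))`. In particular the law of the pair
is determined by the law of the curve — the uniqueness half of Kemppainen–Smirnov (2017),
Cor. 1.7 ("if either `(γ⁽ⁿ⁾)` or `(W⁽ⁿ⁾)` converges (weakly), also the other one converges and
the limits agree"). [folklore] -/
theorem eq_map_prod_drivingFunction_of_ae_isDrivenBy (hφ : D.IsChordalUniformizing φ)
    (h : ∀ᵐ p ∂ν, Continuous p.2 ∧ Loewner.IsDrivenBy φ.boundaryExtension (D.pt 1) p.2 p.1) :
    ν = ν.fst.map fun c ↦ (c, drivingFunction φ c) := by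
  have hg : Measurable fun c : CurveClass ℂ ↦ (c, drivingFunction φ c) :=
    measurable_id.prodMk (measurable_drivingFunction hφ)
  have hae : (id : CurveClass ℂ × (ℝ≥0 → ℝ) → CurveClass ℂ × (ℝ≥0 → ℝ)) =ᵐ[ν]
      (fun c : CurveClass ℂ ↦ (c, drivingFunction φ c)) ∘ Prod.fst := by
    filter_upwards [ae_eq_drivingFunction_of_ae_isDrivenBy hφ h] with p hp
    exact Prod.ext rfl hp
  calc ν = ν.map id := Measure.map_id.symm
    _ = ν.map ((fun c : CurveClass ℂ ↦ (c, drivingFunction φ c)) ∘ Prod.fst) :=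
        Measure.map_congr hae
    _ = ν.fst.map fun c ↦ (c, drivingFunction φ c) := by
        rw [Measure.fst, Measure.map_map hg measurable_fst]

/-- Under such a coupling, **the law of the path is the law of the driving function of the
curve**: `ν.snd = (ν.fst).map (drivingFunction φ)`. [folklore] -/
theorem snd_eq_map_drivingFunction_of_ae_isDrivenBy (hφ : D.IsChordalUniformizing φ)
    (h : ∀ᵐ p ∂ν, Continuous p.2 ∧ Loewner.IsDrivenBy φ.boundaryExtension (D.pt 1) p.2 p.1) :
    ν.snd = ν.fst.map (drivingFunction φ) := by
  have hae : (Prod.snd : CurveClass ℂ × (ℝ≥0 → ℝ) → (ℝ≥0 → ℝ)) =ᵐ[ν]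
      drivingFunction φ ∘ Prod.fst := ae_eq_drivingFunction_of_ae_isDrivenBy hφ h
  rw [Measure.snd, Measure.map_congr hae, Measure.fst,
    Measure.map_map (measurable_drivingFunction hφ) measurable_fst]

end Coupling

section PathCoupling

variable {ν : Measure (CurveClass ℂ × C(ℝ≥0, ℝ))}

/-- Path-space form (couplings on `CurveClass ℂ × C([0, ∞), ℝ)`, the setting of
Kemppainen–Smirnov's Cor. 1.7): under a coupling in which a.e. the path describes the curve, the
path is a.e. the driving path of the curve. [folklore] -/
theorem ae_eq_drivingPath_of_ae_isLoewnerDescribed (hφ : D.IsChordalUniformizing φ)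
    (h : ∀ᵐ p ∂ν, IsLoewnerDescribed φ p.1 p.2) :
    ∀ᵐ p ∂ν, p.2 = ⟨drivingFunction φ p.1, continuous_drivingFunction φ p.1⟩ := by
  filter_upwards [h] with p hp
  ext t
  exact congrFun (IsLoewnerDescribed.drivingFunction_eq IsLoewnerDescribed.driving_unique_holds
    hφ hp).symm t

/-- Path-space form of the graph-coupling identity: a coupling on `CurveClass ℂ × C([0, ∞), ℝ)`
under which a.e. the path describes the curve is the push-forward of its curve marginal under
`c ↦ (c, W(c))`; in particular it is determined by the law of the curve (Kemppainen–Smirnov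
2017, Cor. 1.7). [folklore] -/
theorem eq_map_prod_drivingPath_of_ae_isLoewnerDescribed (hφ : D.IsChordalUniformizing φ)
    (h : ∀ᵐ p ∂ν, IsLoewnerDescribed φ p.1 p.2) :
    ν = ν.fst.map fun c ↦ (c, (⟨drivingFunction φ c, continuous_drivingFunction φ c⟩ : C(ℝ≥0, ℝ))) := by
  have hg : Measurable fun c : CurveClass ℂ ↦
      (c, (⟨drivingFunction φ c, continuous_drivingFunction φ c⟩ : C(ℝ≥0, ℝ))) :=
    measurable_id.prodMk (measurable_drivingPathOf hφ)
  have hae : (id : CurveClass ℂ × C(ℝ≥0, ℝ) → CurveClass ℂ × C(ℝ≥0, ℝ)) =ᵐ[ν]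
      (fun c : CurveClass ℂ ↦
        (c, (⟨drivingFunction φ c, continuous_drivingFunction φ c⟩ : C(ℝ≥0, ℝ)))) ∘ Prod.fst := by
    filter_upwards [ae_eq_drivingPath_of_ae_isLoewnerDescribed hφ h] with p hp
    exact Prod.ext rfl hp
  calc ν = ν.map id := Measure.map_id.symm
    _ = ν.map ((fun c : CurveClass ℂ ↦
          (c, (⟨drivingFunction φ c, continuous_drivingFunction φ c⟩ : C(ℝ≥0, ℝ)))) ∘ Prod.fst) :=
        Measure.map_congr hae
    _ = ν.fst.map fun c ↦
          (c, (⟨drivingFunction φ c, continuous_drivingFunction φ c⟩ : C(ℝ≥0, ℝ))) := by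
        rw [Measure.fst, Measure.map_map hg measurable_fst]

/-- Path-space form: the law of the path is the law of the driving path of the curve.
[folklore] -/
theorem snd_eq_map_drivingPath_of_ae_isLoewnerDescribed (hφ : D.IsChordalUniformizing φ)
    (h : ∀ᵐ p ∂ν, IsLoewnerDescribed φ p.1 p.2) :
    ν.snd = ν.fst.map fun c ↦
      (⟨drivingFunction φ c, continuous_drivingFunction φ c⟩ : C(ℝ≥0, ℝ)) := by
  have hae : (Prod.snd : CurveClass ℂ × C(ℝ≥0, ℝ) → C(ℝ≥0, ℝ)) =ᵐ[ν]
      (fun c ↦ (⟨drivingFunction φ c, continuous_drivingFunction φ c⟩ : C(ℝ≥0, ℝ))) ∘ Prod.fst :=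
    ae_eq_drivingPath_of_ae_isLoewnerDescribed hφ h
  rw [Measure.snd, Measure.map_congr hae, Measure.fst,
    Measure.map_map (measurable_drivingPathOf hφ) measurable_fst]

end PathCoupling

/-! ### Consequences: the Brownian coupling and the SLE law from the law of the driving function -/

variable {κ : ℝ≥0}

/-- `exists_isSLEDrivingCoupling_of_drivingFunction` (`LoewnerDescription.lean`) with its
a.e.-measurability hypothesis discharged by `measurable_drivingFunction`: if `μ`-a.e. curve class
is describable through the chordal uniformizing map `φ` and the law of `W/√κ` under `μ` is the
law of the canonical Brownian path, then `μ` admits a Brownian coupling of its driving process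
(Duminil-Copin–Smirnov 2012, Prop. 6.7; CDHKS 2014, §3). [cite: DuminilCopinSmirnov2012Clay, Prop. 6.7] -/
theorem exists_isSLEDrivingCoupling_of_drivingFunction' (hκ : 0 < κ)
    (hφ : D.IsChordalUniformizing φ) {μ : Measure (CurveClass ℂ)} [IsFiniteMeasure μ]
    (hdesc : ∀ᵐ c ∂μ, IsLoewnerDescribable φ c)
    (hlaw : μ.map (fun c t ↦ drivingFunction φ c t / Real.sqrt κ) =
      Process.preWienerMeasure.map brownianPath) :
    ∃ ν, IsSLEDrivingCoupling κ D φ μ ν :=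
  exists_isSLEDrivingCoupling_of_drivingFunction hκ hdesc (aemeasurable_drivingFunction hφ μ) hlaw

/-- `isSLELaw_of_drivingFunction` (`LoewnerDescription.lean`) with its a.e.-measurability
hypothesis discharged: under the Rohde–Schramm trace facts, a law `μ` on curve classes whose
classes are a.e. describable through `φ` and whose driving function has the law of `√κ B` is the
chordal SLE_κ law of `(D; a, b)` (Duminil-Copin–Smirnov 2012, Prop. 6.7: "this is exactly the
definition of the chordal Schramm–Loewner Evolution … in the domain `(Ω, a, b)`").
[cite: DuminilCopinSmirnov2012Clay, Prop. 6.7] -/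
theorem isSLELaw_of_drivingFunction' (hκt : HasSLETrace κ) (hκ : 0 < κ)
    (htr : tendsto_norm_sleTrace_atTop) (hφ : D.IsChordalUniformizing φ)
    {μ : Measure (CurveClass ℂ)} [IsFiniteMeasure μ] (hdesc : ∀ᵐ c ∂μ, IsLoewnerDescribable φ c)
    (hlaw : μ.map (fun c t ↦ drivingFunction φ c t / Real.sqrt κ) =
      Process.preWienerMeasure.map brownianPath) :
    IsSLELaw κ D μ :=
  isSLELaw_of_drivingFunction hκt hκ htr hφ hdesc (aemeasurable_drivingFunction hφ μ) hlaw

/-! ### End points of described curve classes, and `W 0 = 0` -/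

/-- A curve class described through `φ` by `W` **starts at `Φ(W 0)`** (`Φ` the boundary extension
of `φ`): the generating curve starts at `γ(0) = W(0)` (`Loewner.IsGeneratedByCurve.apply_zero`)
and the compactified image at `Φ(γ(0))`. [folklore] -/
theorem IsLoewnerDescribed.source_eq {c : CurveClass ℂ} {W : ℝ≥0 → ℝ}
    (h : IsLoewnerDescribed φ c W) : c.source = φ.boundaryExtension (W 0) := by
  obtain ⟨-, γ, hγ, c', rfl, hI⟩ := h
  rw [CurveClass.source_mk, Curve.source, hI.1 0 (by norm_num), rayParam_zero, hγ.apply_zero]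

/-- A curve class described through `φ` **ends at `b = D.pt 1`**. [folklore] -/
theorem IsLoewnerDescribed.target_eq {c : CurveClass ℂ} {W : ℝ≥0 → ℝ}
    (h : IsLoewnerDescribed φ c W) : c.target = D.pt 1 := by
  obtain ⟨-, γ, -, c', rfl, hI⟩ := h
  rw [CurveClass.target_mk, Curve.target, hI.2]

/-- **`W 0 = 0` for curves from `a`**: if the curve class `c` starts at `a = D.pt 0` and is
described through the chordal uniformizing map `φ` (boundary value `a` at `0`) by `W`, then
`W 0 = 0` — the boundary extension of `φ` is injective on the closed half-plane
(`JordanDomain.injOn_boundaryExtension`) and `Φ(W 0) = a = Φ(0)`. This is the normalisation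
"`γ̃(0) = 0`" of Kemppainen–Smirnov (2017), §1.2, and the clause `W c 0 = 0` of (M5′)
`LatticeModels.exists_cylinderObservableIdentity_fkInterface` for the driving function of a
limit law carried by curves from `a`. [folklore] -/
theorem IsLoewnerDescribed.driving_zero (hφ : D.IsChordalUniformizing φ) {c : CurveClass ℂ}
    {W : ℝ≥0 → ℝ} (h : IsLoewnerDescribed φ c W) (h0 : c.source = D.pt 0) : W 0 = 0 := by
  have h1 : φ.boundaryExtension (W 0) = φ.boundaryExtension 0 := by
    rw [← h.source_eq, h0]
    exact (φ.boundaryExtension_eq_of_hasBoundaryValue (by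
      rw [ConformalEquiv.closure_upperHalfPlaneSet_eq]
      simp) hφ.1).symm
  have h2 : ((W 0 : ℝ) : ℂ) = 0 :=
    JordanDomain.injOn_boundaryExtension φ (by simp) (by simp) h1
  exact_mod_cast h2

/-- **The driving function of a curve class from `a` vanishes at time `0`** (for a chordal
uniformizing map `φ`): either the class is describable and `IsLoewnerDescribed.driving_zero`
applies, or the driving function is the junk `0`. [folklore] -/
theorem drivingFunction_apply_zero (hφ : D.IsChordalUniformizing φ) {c : CurveClass ℂ}
    (h0 : c.source = D.pt 0) : drivingFunction φ c 0 = 0 := by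
  by_cases h : IsLoewnerDescribable φ c
  · exact (isLoewnerDescribed_drivingFunction h).driving_zero hφ h0
  · rw [drivingFunction_of_not h]
    rfl

/-- The set of curve classes starting at a given point is closed (the starting point is a
continuous function of the class, `CurveClass.continuous_source`). [folklore] -/
theorem CurveClass.isClosed_setOf_source_eq (a : ℂ) : IsClosed {c : CurveClass ℂ | c.source = a} :=
  isClosed_eq CurveClass.continuous_source continuous_const

/-- Hence, for a law `μ` on curve classes carried by curves from `a` (e.g. a subsequential limit
of interface laws whose discrete curves start at points `a_δ → a`: the set `{source = a}` is
closed), the driving function vanishes at time `0` almost surely. [folklore] -/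
theorem ae_drivingFunction_apply_zero (hφ : D.IsChordalUniformizing φ) {μ : Measure (CurveClass ℂ)}
    (h0 : ∀ᵐ c ∂μ, c.source = D.pt 0) : ∀ᵐ c ∂μ, drivingFunction φ c 0 = 0 := by
  filter_upwards [h0] with c hc
  exact drivingFunction_apply_zero hφ hc


end Literature.Probability.RandomPlanarGeometry
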